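import Summits.BirchSwinnertonDyer.BirchSwinnertonDyer.Theorems.PrintCFramBottomClassIndexLawFiveLeKrizLiBindersKroneckerOdd
import Literature.NumberTheory.EllipticCurves.KrizLi2019.EisensteinHeegnerLog
import Literature.NumberTheory.QuadraticFields.KroneckerSplitting
import HarnessLib

/-!
# Crux `PrintCFram.BottomClassIndexLawFiveLe` (stmt-BirchSwinnertonDyer-20372), line `eisenstein-resource-bdp-line`:
# the KRIZ–LI BINDERS CLASS-LEVEL, part E — the binder `ε_K`: for a quadratic field `M` of ODD discriminant `d_M = ±m`
# the `ℚ_p`-valued Kronecker character `IsKroneckerCharacterOf M ε` EXISTS (it is `J(· | m)` at level `|d_M|`), any prime `p`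
# (cell `bsd-print-cfram`, width seat `bsd-line-cfram-p1-w3` g2; THEOREMS ONLY, `--supports` 20372; BSD is not proved by any of this)

HONEST FRAMING. Nothing here is a statement about BSD. Besides the character block `(f, ψ, ω)` (parts K/Ψ/T/W/M of this
series) the «Kriz–Li datum» of the line binds `εK : DirichletCharacter ℚ_[p] |d_K''|` with `KrizLi2019.IsKroneckerCharacterOf K'' εK`
(primitive; value `+1 / −1` at a prime `ℓ ∤ d_K''` according as `ℓ` splits / is inert). Cell `bsd-cm`'s Route U supplied it at
`p = 7` (`RouteUQuadraticTwin.isKroneckerCharacterOf_changeLevel_jacobi`, `ℚ_7`-valued); this file is the port to every prime `p`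
(proofs verbatim, `ℚ_7 → ℚ_p`), plus the EXISTENCE statement the datum needs (from part K-odd's `exists_jacobiCharPadic`):

* `kroneckerValue_of_discr_eq_pos` / `kroneckerValue_of_discr_eq_neg` — decomposition law read on a character with values
  `J(· | m)`, `d_M = m ≡ 1 (mod 4)` resp. `d_M = −m`, `m ≡ 3 (mod 4)`;
* `isKroneckerCharacterOf_changeLevel_jacobi` — such a primitive `κ` mod `m`, lifted to level `|d_M|`, IS the Kronecker character;
* **`exists_isKroneckerCharacterOf_of_discr`** — for `d_M = ±m` odd with `m` squarefree: `∃ ε, IsKroneckerCharacterOf M ε` with the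
  values `ε(a) = J(a | m)` recorded (the shape consumed by Bernoulli-(4) certificates).

beyond-print theorem: NO. References: [KrizLi2019] §2 (p. 12, `ε_K`); [Cox2013] §1.C Lemma 1.14, (1.18); [MontgomeryVaughan2007] Thm. 9.13.
-/

noncomputable section

-- summit-side namespace `Summit.BirchSwinnertonDyer.BirchSwinnertonDyer.…` (single-conjunct summit, D-0017 layout)
set_option linter.dupNamespace false

open scoped Classical NumberTheorySymbols
open NumberField DirichletCharacter
open Literature.NumberTheory.EllipticCurves.KrizLi2019 Literature.NumberTheory.QuadraticFields

namespace Summit.BirchSwinnertonDyer.BirchSwinnertonDyer.Theorems.PrintCFram.KrizLiBinders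

variable {p : ℕ} [hp : Fact p.Prime] {M : Type} [Field M] [NumberField M]

/-- **Decomposition law read on the Jacobi character, positive discriminant `m ≡ 1 (mod 4)`**: if `d_M = m` and `κ` (any level)
has values `J(· | m)`, then for every prime `ℓ ∤ d_M`: `κ(ℓ) = 1` if `ℓ` splits in `M`, `−1` otherwise.
-- adapted from Summits/BirchSwinnertonDyer/Rank1Residual/X12/O11/RouteUQuadraticTwin.lean (ℚ_7-valued)
[cite: Cox2013, §1.C Lemma 1.14 and (1.18)] -/
theorem kroneckerValue_of_discr_eq_pos (hM2 : Module.finrank ℚ M = 2) {m : ℕ} (hm4 : m % 4 = 1)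
    (hdM : NumberField.discr M = m) {n : ℕ} (κ : DirichletCharacter ℚ_[p] n)
    (hκ : ∀ a : ℕ, κ (a : ZMod n) = (J((a : ℤ) | m) : ℚ_[p]))
    (ℓ : ℕ) (hℓ : ℓ.Prime) (hnd : ¬ ((ℓ : ℤ) ∣ NumberField.discr M)) :
    κ (ℓ : ZMod n) = if ((Ideal.span {(ℓ : ℤ)}).primesOver (𝓞 M)).ncard = 2 then 1 else -1 := by
  have hmodd : Odd m := Nat.odd_iff.mpr (by omega)
  have hcop : (ℓ : ℤ).gcd m = 1 := by
    rw [Int.gcd_natCast_natCast, ← Nat.coprime_iff_gcd_eq_one, Nat.Prime.coprime_iff_not_dvd hℓ]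
    intro h; apply hnd; rw [hdM]; exact_mod_cast h
  rw [hκ ℓ]
  by_cases h2 : ℓ = 2
  · subst h2
    have hJ : J((2 : ℕ) | m) = ZMod.χ₈ m := by exact_mod_cast jacobiSym.at_two hmodd
    have h8 := ZMod.χ₈_nat_eq_if_mod_eight m
    by_cases hs : ((Ideal.span {((2 : ℕ) : ℤ)}).primesOver (𝓞 M)).ncard = 2
    · rw [if_pos hs]
      have h1 : NumberField.discr M % 8 = 1 := by
        rw [Nat.cast_ofNat, Quadratic.ncard_primesOver_two_eq_two_iff hM2] at hs; exact hs
      rw [hdM] at h1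
      have : m % 8 = 1 := by omega
      rw [hJ, h8, if_neg (by omega), if_pos (Or.inl this)]; simp
    · rw [if_neg hs]
      have h1 : NumberField.discr M % 8 ≠ 1 := by
        rw [Nat.cast_ofNat, Quadratic.ncard_primesOver_two_eq_two_iff hM2] at hs; exact hs
      rw [hdM] at h1
      have : ¬ (m % 8 = 1 ∨ m % 8 = 7) := by omega
      rw [hJ, h8, if_neg (by omega), if_neg this]; simp
  · haveI := Fact.mk hℓ
    have hodd : Odd ℓ := hℓ.odd_of_ne_two h2
    have hrec : J((ℓ : ℤ) | m) = legendreSym ℓ (NumberField.discr M) := by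
      rw [hdM, jacobiSym.legendreSym.to_jacobiSym, jacobiSym.quadratic_reciprocity_one_mod_four' hodd hm4]
    rcases jacobiSym.eq_one_or_neg_one hcop with h1 | h1
    · rw [h1, if_pos ((Quadratic.ncard_primesOver_eq_two_iff_legendreSym hM2 h2).mpr (by rw [← hrec, h1])),
        Int.cast_one]
    · have hs : ((Ideal.span {(ℓ : ℤ)}).primesOver (𝓞 M)).ncard ≠ 2 := fun hs => by
        have := (Quadratic.ncard_primesOver_eq_two_iff_legendreSym hM2 h2).mp hs
        rw [← hrec, h1] at this; norm_num at this
      rw [h1, if_neg hs, Int.cast_neg, Int.cast_one]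

/-- **Decomposition law read on the Jacobi character, negative discriminant `−m`, `m ≡ 3 (mod 4)`**: if `d_M = −m` and `κ` has
values `J(· | m)`, then `κ(ℓ) = ±1` by splitting, for every prime `ℓ ∤ d_M` (`J(ℓ | m) = J(−m | ℓ)`; at `2`: `m ≡ 7 (mod 8)`).
-- adapted from Summits/BirchSwinnertonDyer/Rank1Residual/X12/O11/RouteUQuadraticTwin.lean (ℚ_7-valued)
[cite: Cox2013, §1.C Lemma 1.14 and (1.18)] -/
theorem kroneckerValue_of_discr_eq_neg (hM2 : Module.finrank ℚ M = 2) {m : ℕ} (hm4 : m % 4 = 3)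
    (hdM : NumberField.discr M = -(m : ℤ)) {n : ℕ} (κ : DirichletCharacter ℚ_[p] n)
    (hκ : ∀ a : ℕ, κ (a : ZMod n) = (J((a : ℤ) | m) : ℚ_[p]))
    (ℓ : ℕ) (hℓ : ℓ.Prime) (hnd : ¬ ((ℓ : ℤ) ∣ NumberField.discr M)) :
    κ (ℓ : ZMod n) = if ((Ideal.span {(ℓ : ℤ)}).primesOver (𝓞 M)).ncard = 2 then 1 else -1 := by
  have hmodd : Odd m := Nat.odd_iff.mpr (by omega)
  have hcop : (ℓ : ℤ).gcd m = 1 := by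
    rw [Int.gcd_natCast_natCast, ← Nat.coprime_iff_gcd_eq_one, Nat.Prime.coprime_iff_not_dvd hℓ]
    intro h; apply hnd; rw [hdM, dvd_neg]; exact_mod_cast h
  rw [hκ ℓ]
  by_cases h2 : ℓ = 2
  · subst h2
    have hJ : J((2 : ℕ) | m) = ZMod.χ₈ m := by exact_mod_cast jacobiSym.at_two hmodd
    have h8 := ZMod.χ₈_nat_eq_if_mod_eight m
    by_cases hs : ((Ideal.span {((2 : ℕ) : ℤ)}).primesOver (𝓞 M)).ncard = 2
    · rw [if_pos hs]
      have h1 : NumberField.discr M % 8 = 1 := by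
        rw [Nat.cast_ofNat, Quadratic.ncard_primesOver_two_eq_two_iff hM2] at hs; exact hs
      rw [hdM] at h1
      have : m % 8 = 7 := by omega
      rw [hJ, h8, if_neg (by omega), if_pos (Or.inr this)]; simp
    · rw [if_neg hs]
      have h1 : NumberField.discr M % 8 ≠ 1 := by
        rw [Nat.cast_ofNat, Quadratic.ncard_primesOver_two_eq_two_iff hM2] at hs; exact hs
      rw [hdM] at h1
      have : ¬ (m % 8 = 1 ∨ m % 8 = 7) := by omega
      rw [hJ, h8, if_neg (by omega), if_neg this]; simp
  · haveI := Fact.mk hℓ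
    have hodd : Odd ℓ := hℓ.odd_of_ne_two h2
    -- `J(ℓ | m) = J(−m | ℓ)`: split `ℓ mod 4`
    have hrec : J((ℓ : ℤ) | m) = legendreSym ℓ (NumberField.discr M) := by
      rw [hdM, jacobiSym.legendreSym.to_jacobiSym, jacobiSym.neg _ hodd]
      rcases Nat.odd_mod_four_iff.mp (Nat.odd_iff.mp hodd) with h1 | h3
      · rw [ZMod.χ₄_nat_one_mod_four h1, one_mul, jacobiSym.quadratic_reciprocity_one_mod_four h1 hmodd]
      · rw [ZMod.χ₄_nat_three_mod_four h3, jacobiSym.quadratic_reciprocity_three_mod_four h3 hm4]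
        ring
    rcases jacobiSym.eq_one_or_neg_one hcop with h1 | h1
    · rw [h1, if_pos ((Quadratic.ncard_primesOver_eq_two_iff_legendreSym hM2 h2).mpr (by rw [← hrec, h1])),
        Int.cast_one]
    · have hs : ((Ideal.span {(ℓ : ℤ)}).primesOver (𝓞 M)).ncard ≠ 2 := fun hs => by
        have := (Quadratic.ncard_primesOver_eq_two_iff_legendreSym hM2 h2).mp hs
        rw [← hrec, h1] at this; norm_num at this
      rw [h1, if_neg hs, Int.cast_neg, Int.cast_one]

/-- **The Kronecker character of a quadratic field `M` of odd discriminant `d_M = ±m` is `J(· | m)` transported to level `|d_M|`**: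
if `κ` mod `m` is primitive with values `J(· | m)` and `h : m ∣ |d_M|` (in fact `|d_M| = m`), then
`IsKroneckerCharacterOf M (changeLevel h κ)`, for either sign.
-- adapted from Summits/BirchSwinnertonDyer/Rank1Residual/X12/O11/RouteUQuadraticTwin.lean (ℚ_7-valued)
[cite: KrizLi2019, §2 (p. 12, "ε_K the quadratic character associated with K")] [cite: Cox2013, §1.C Lemma 1.14] -/
theorem isKroneckerCharacterOf_changeLevel_jacobi (hM2 : Module.finrank ℚ M = 2) {m : ℕ} [NeZero m]
    (hsign : (NumberField.discr M = m ∧ m % 4 = 1) ∨ (NumberField.discr M = -(m : ℤ) ∧ m % 4 = 3))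
    (κ : DirichletCharacter ℚ_[p] m) (hκp : κ.IsPrimitive)
    (hκ : ∀ a : ℕ, κ (a : ZMod m) = (J((a : ℤ) | m) : ℚ_[p]))
    (h : m ∣ (NumberField.discr M).natAbs) :
    IsKroneckerCharacterOf M (changeLevel h κ) := by
  have hnat : (NumberField.discr M).natAbs = m := by
    rcases hsign with ⟨hd, -⟩ | ⟨hd, -⟩ <;> simp [hd]
  refine ⟨?_, fun ℓ hℓ hnd => ?_⟩
  · rw [isPrimitive_def, conductor_changeLevel, hκp, hnat]
  · have hcop : IsCoprime (ℓ : ℤ) ((NumberField.discr M).natAbs : ℕ) := by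
      rw [Int.isCoprime_iff_gcd_eq_one, Int.gcd_natCast_natCast, ← Nat.coprime_iff_gcd_eq_one,
        Nat.Prime.coprime_iff_not_dvd hℓ]
      intro hdvd; apply hnd
      exact Int.dvd_natAbs.mp (by exact_mod_cast hdvd)
    have hval : changeLevel h κ (ℓ : ZMod (NumberField.discr M).natAbs) = κ (ℓ : ZMod m) := by
      have := changeLevel_eq_cast_of_dvd' κ h hcop
      simpa [Int.cast_natCast] using this
    rw [hval]
    rcases hsign with ⟨hd, h4⟩ | ⟨hd, h4⟩
    · exact kroneckerValue_of_discr_eq_pos hM2 h4 hd κ hκ ℓ hℓ hnd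
    · exact kroneckerValue_of_discr_eq_neg hM2 h4 hd κ hκ ℓ hℓ hnd

/-- **Existence of the binder `ε_K` for a quadratic field of odd discriminant `±m` (`m` squarefree), in `ℚ_p`, with its values.**
There is `ε : DirichletCharacter ℚ_[p] |d_M|` with `IsKroneckerCharacterOf M ε` and `ε(a) = J(a | m)` for every `a : ℕ` — the
Kronecker character `(d_M / ·)` (Cox Lemma 1.14), from part K-odd (`exists_jacobiCharPadic`, `isPrimitive_of_forall_eq_jacobiSym`).
[cite: KrizLi2019, §2 (p. 12, ε_K)] [cite: Cox2013, §1.C Lemma 1.14] [cite: MontgomeryVaughan2007, Theorem 9.13] -/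
theorem exists_isKroneckerCharacterOf_of_discr (hM2 : Module.finrank ℚ M = 2) {m : ℕ} (hsq : Squarefree m)
    (hsign : (NumberField.discr M = m ∧ m % 4 = 1) ∨ (NumberField.discr M = -(m : ℤ) ∧ m % 4 = 3)) :
    ∃ ε : DirichletCharacter ℚ_[p] (NumberField.discr M).natAbs,
      IsKroneckerCharacterOf M ε ∧ ∀ a : ℕ, ε (a : ZMod (NumberField.discr M).natAbs) = (J((a : ℤ) | m) : ℚ_[p]) := by
  have hnat : (NumberField.discr M).natAbs = m := by
    rcases hsign with ⟨hd, -⟩ | ⟨hd, -⟩ <;> simp [hd]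
  haveI : NeZero m := ⟨hsq.ne_zero⟩
  have hodd : Odd m := by rcases hsign with ⟨-, h4⟩ | ⟨-, h4⟩ <;> exact Nat.odd_iff.mpr (by omega)
  obtain ⟨κ, hκ⟩ := exists_jacobiCharPadic (p := p) m
  have h : m ∣ (NumberField.discr M).natAbs := hnat ▸ dvd_rfl
  refine ⟨changeLevel h κ, isKroneckerCharacterOf_changeLevel_jacobi hM2 hsign κ
    (isPrimitive_of_forall_eq_jacobiSym hκ hodd hsq) hκ h, fun a => ?_⟩
  -- values: at `a` coprime to `m` by `changeLevel_eq_cast_of_dvd'`; otherwise both sides vanish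
  by_cases ha : a.Coprime m
  · have hcop : IsCoprime (a : ℤ) ((NumberField.discr M).natAbs : ℕ) := by
      rw [hnat]; exact Nat.isCoprime_iff_coprime.mpr ha
    have := changeLevel_eq_cast_of_dvd' κ h hcop
    simp only [Int.cast_natCast] at this
    rw [this, hκ a]
  · have hnu : ¬ IsUnit (a : ZMod (NumberField.discr M).natAbs) := by
      rw [ZMod.isUnit_iff_coprime, hnat]; exact ha
    rw [MulChar.map_nonunit _ hnu, eq_comm, Int.cast_eq_zero, jacobiSym.eq_zero_iff_not_coprime, Int.gcd_natCast_natCast]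
    exact ha

end Summit.BirchSwinnertonDyer.BirchSwinnertonDyer.Theorems.PrintCFram.KrizLiBinders

end
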